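import Literature.Analysis.FluidPDE.FluidComputer.ThresholdTransferCertificate
import HarnessLib

/-!
# Fluid computer blueprint — threshold gate: the LEVEL CHAIN of the transfer stage

HONEST FRAMING: low prior, high value-of-information experiment on Tao's machine paradigm; NOT a
claim that NS blows up. Elementary composition of certificates for the 5-mode circuit
`thresholdCircuit ε σ ν μ r κ`; nothing is asserted about any fluid equation.

## What this file is (bp3 gen 12)

The landed stage-3 theorem `exists_output_loaded` / certificate `transferStage`
(`ThresholdTransferStage`, `ThresholdTransferCertificate`) has closed-form hypotheses that are
EMPTY on the design ladder (`ThresholdTransferNecessary.transfer_hypotheses_necessary`). The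
numerics (`bookkeep.py` v5, `bookkeep_v6.py`; `pub-fluidc/data/thgate/bookkeep-g11,g12`) show what
does close: a CHAIN of sub-windows delimited by the LEVELS `C₀ < C₁ < ⋯ < C_n` of the monotone
trigger, each sub-window certified by a LEVEL STEP (an interval box at level `k` is carried to an
interval box at level `k + 1` within a time `≤ dur k`; rungs in `ThresholdLevelRungs`).

This file is the soft part that makes the chain a certificate, independently of how each step is
proved:

* `IsForcedWindow.level_chain` — **composition along the chain**: if every level step holds for
  every forced window of length `dur k` in the ball that starts in the box of level `k`, then a
  forced window of length `T ≥ ∑ dur k` starting in the box of level `0` visits the box of level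
  `n` at some time `t ≤ ∑ dur k` (induction on `n`, restarting the window at the level times by
  `IsForcedWindow.shift` / `mono`).
* `IsForcedWindow.exists_output_of_level_chain` — with an exit implication
  `Box n X → E_out ≤ X₄²` this concludes EXACTLY `∃ t ∈ [0, T], E_out ≤ ã(t)²`, the REACH
  statement of stage 3.
* `transferStageOfReach` — **any** REACH theorem of that shape over the energy ball, together
  with the energy bookkeeping `E(p) + 10δR_b T₃ < R_b²`, is a
  `ReachCertificate (thresholdCircuit …) (modeBall R_b) δ T₃ Ain (outputLoaded E_out)` with the
  energy tube (same AVOID half as `transferStage`); `levelTransferStage` is the instance fed by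
  the level chain, and `levelFullCycle` / `levelFullCycle_reach` compose it after any earlier-stage
  certificate exactly as `fullCycle` / `fullCycle_reach` do.

So once the level step is inhabited on a design (interval table, `ThresholdLevelStep` + a ℚ
instance), the full-cycle certificate and its hypothesis-free REACH corollary follow by these
definitions with no further analysis. [cite: Tao2016AveragedNS, §5.5 Thm 5.3 (5.5)]
-/

noncomputable section

open Set Filter Topology
open scoped NNReal

namespace Literature.Analysis.FluidPDE.FluidComputer

open Literature.Analysis.FluidPDE.Tao2016AveragedNS Literature.Analysis.ODE

variable {ε σ ν μ r κ δ : ℝ}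

namespace IsForcedWindow

/-- **THE LEVEL CHAIN.** Let `Box k` be the entry condition at level `k` and `dur k ≥ 0` the time
allowed for the step `k → k + 1`. If every forced window of length `dur k` lying in the ball
`|xᵢ| < R_b` and starting in `Box k` visits `Box (k + 1)` (the LEVEL STEP, for each `k < n`), then a
forced window of length `T ≥ ∑_{k<n} dur k` in the ball starting in `Box 0` visits `Box n` at some
time `t ∈ [0, ∑_{k<n} dur k]`. [folklore] -/
theorem level_chain {T Rb : ℝ} {x : ℝ → Fin 5 → ℝ} (h : IsForcedWindow ε σ ν μ r κ δ T x)
    (hball : ∀ t ∈ Ico 0 T, ∀ i, |x t i| < Rb) (Box : ℕ → (Fin 5 → ℝ) → Prop) (dur : ℕ → ℝ)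
    (hdur : ∀ k, 0 ≤ dur k) (n : ℕ) (htime : ∑ k ∈ Finset.range n, dur k ≤ T)
    (hstep : ∀ k < n, ∀ y : ℝ → Fin 5 → ℝ, IsForcedWindow ε σ ν μ r κ δ (dur k) y →
      (∀ t ∈ Ico 0 (dur k), ∀ i, |y t i| < Rb) → Box k (y 0) →
        ∃ t ∈ Icc 0 (dur k), Box (k + 1) (y t))
    (h0 : Box 0 (x 0)) :
    ∃ t ∈ Icc 0 (∑ k ∈ Finset.range n, dur k), Box n (x t) := by
  induction n with
  | zero => exact ⟨0, by simp, h0⟩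
  | succ n ih =>
    have hsum : ∑ k ∈ Finset.range (n + 1), dur k = ∑ k ∈ Finset.range n, dur k + dur n :=
      Finset.sum_range_succ _ _
    have htime' : ∑ k ∈ Finset.range n, dur k ≤ T := by
      rw [hsum] at htime; linarith [hdur n]
    obtain ⟨s, hs, hBs⟩ := ih htime' (fun k hk => hstep k (Nat.lt_succ_of_lt hk))
    have hsT : s ∈ Icc 0 T := ⟨hs.1, hs.2.trans htime'⟩
    have hlen : dur n ≤ T - s := by rw [hsum] at htime; linarith [hs.2]
    have hy : IsForcedWindow ε σ ν μ r κ δ (dur n) (fun u => x (s + u)) := (h.shift hsT).mono hlen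
    have hyball : ∀ t ∈ Ico 0 (dur n), ∀ i, |x (s + t) i| < Rb := fun t ht i =>
      hball (s + t) ⟨by linarith [hs.1, ht.1], by linarith [ht.2]⟩ i
    obtain ⟨t, ht, hBt⟩ :=
      hstep n (Nat.lt_succ_self n) (fun u => x (s + u)) hy hyball (by simpa using hBs)
    refine ⟨s + t, ⟨by linarith [hs.1, ht.1], ?_⟩, hBt⟩
    rw [hsum]; linarith [hs.2, ht.2]

/-- **REACH from the level chain**: with an exit implication at the last level, the chain
concludes exactly the REACH statement of stage 3: `∃ t ∈ [0, T], E_out ≤ ã(t)²`. [folklore] -/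
theorem exists_output_of_level_chain {T Rb Eout : ℝ} {x : ℝ → Fin 5 → ℝ}
    (h : IsForcedWindow ε σ ν μ r κ δ T x) (hball : ∀ t ∈ Ico 0 T, ∀ i, |x t i| < Rb)
    (Box : ℕ → (Fin 5 → ℝ) → Prop) (dur : ℕ → ℝ) (hdur : ∀ k, 0 ≤ dur k) (n : ℕ)
    (htime : ∑ k ∈ Finset.range n, dur k ≤ T)
    (hstep : ∀ k < n, ∀ y : ℝ → Fin 5 → ℝ, IsForcedWindow ε σ ν μ r κ δ (dur k) y →
      (∀ t ∈ Ico 0 (dur k), ∀ i, |y t i| < Rb) → Box k (y 0) →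
        ∃ t ∈ Icc 0 (dur k), Box (k + 1) (y t))
    (h0 : Box 0 (x 0)) (hexit : ∀ X, Box n X → Eout ≤ X 4 ^ 2) :
    ∃ t ∈ Icc 0 T, Eout ≤ x t 4 ^ 2 := by
  obtain ⟨t, ht, hB⟩ := h.level_chain hball Box dur hdur n htime hstep h0
  exact ⟨t, ⟨ht.1, ht.2.trans htime⟩, hexit _ hB⟩

end IsForcedWindow

/-! ### Stage 3 as a certificate from ANY reach theorem over the energy ball -/

/-- **STAGE 3 FROM A REACH THEOREM.** Working region the energy ball `modeBall R_b`, defect `δ`,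
length `T₃`, tube the energy tube. AVOID is energy bookkeeping (`hE`); REACH is the hypothesis
`hreach`: every forced window of length `T₃` from `p ∈ Ain` inside the ball loads the output to
`E_out` at some time. This is `transferStage` with its closed-form REACH engine abstracted, so that
the level chain (or any future engine) re-inhabits the certificate verbatim.
[cite: Tao2016AveragedNS, §5.5 Thm 5.3 (5.5)] -/
def transferStageOfReach (ε σ ν μ r κ δ Rb T₃ Eout : ℝ) (Ain : Set (Fin 5 → ℝ))
    (hκ : 0 ≤ κ) (hδ : 0 ≤ δ) (hRb : 0 ≤ Rb)
    (hE : ∀ p ∈ Ain, energy p + 10 * (δ * Rb) * T₃ < Rb ^ 2)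
    (hreach : ∀ p ∈ Ain, ∀ x : ℝ → Fin 5 → ℝ, x 0 = p → IsForcedWindow ε σ ν μ r κ δ T₃ x →
      (∀ t ∈ Ico 0 T₃, ∀ i, |x t i| < Rb) → ∃ t ∈ Icc 0 T₃, Eout ≤ x t 4 ^ 2) :
    ReachCertificate (thresholdCircuit ε σ ν μ r κ) (modeBall Rb) δ T₃ Ain (outputLoaded Eout) where
  Tube p t := energyTube δ Rb p t
  Tube_closed p _ := isClosed_energyTube_graph δ Rb T₃ p
  Tube_zero p _ := self_mem_energyTube_zero δ Rb p
  Tube_sub p hp t ht := energyTube_subset_modeBall hRb hδ ht (hE p hp)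
  cert p hp σT x h0 hσT hx0 hcont hU hder := by
    have hW : IsForcedWindow ε σ ν μ r κ δ σT x := ⟨hcont, hder⟩
    have hUlt : ∀ t ∈ Ico 0 σT, ∀ i, |x t i| < Rb := fun t ht i =>
      (show ∀ j, |x t j| < Rb from hU t ht) i
    refine ⟨?_, fun hEq => ?_⟩
    · rw [← hx0]
      exact hW.mem_energyTube hκ hRb (fun t ht i => (hUlt t ht i).le) σT ⟨h0, le_rfl⟩
    · subst hEq
      exact hreach p hp x hx0 hW hUlt

/-- **STAGE 3 FROM THE LEVEL CHAIN.** The certificate of `transferStageOfReach` whose REACH engine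
is `exists_output_of_level_chain`: boxes `Box k` at the trigger levels, step durations `dur k ≥ 0`
with `∑_{k<n} dur k ≤ T₃`, every input in `Box 0`, the level step for each `k < n` (for every forced
window of length `dur k` in the ball), and the exit implication at level `n`.
[cite: Tao2016AveragedNS, §5.5 Thm 5.3 (5.5)] -/
def levelTransferStage (ε σ ν μ r κ δ Rb T₃ Eout : ℝ) (Ain : Set (Fin 5 → ℝ))
    (Box : ℕ → (Fin 5 → ℝ) → Prop) (dur : ℕ → ℝ) (n : ℕ)
    (hκ : 0 ≤ κ) (hδ : 0 ≤ δ) (hRb : 0 ≤ Rb) (hdur : ∀ k, 0 ≤ dur k)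
    (htime : ∑ k ∈ Finset.range n, dur k ≤ T₃)
    (hE : ∀ p ∈ Ain, energy p + 10 * (δ * Rb) * T₃ < Rb ^ 2) (hin : ∀ p ∈ Ain, Box 0 p)
    (hstep : ∀ k < n, ∀ y : ℝ → Fin 5 → ℝ, IsForcedWindow ε σ ν μ r κ δ (dur k) y →
      (∀ t ∈ Ico 0 (dur k), ∀ i, |y t i| < Rb) → Box k (y 0) →
        ∃ t ∈ Icc 0 (dur k), Box (k + 1) (y t))
    (hexit : ∀ X, Box n X → Eout ≤ X 4 ^ 2) :
    ReachCertificate (thresholdCircuit ε σ ν μ r κ) (modeBall Rb) δ T₃ Ain (outputLoaded Eout) :=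
  transferStageOfReach ε σ ν μ r κ δ Rb T₃ Eout Ain hκ hδ hRb hE fun p hp _ hx0 hW hball =>
    hW.exists_output_of_level_chain hball Box dur hdur n htime hstep (hx0 ▸ hin p hp) hexit

/-- **THE FULL CYCLE WITH A LEVEL-CHAIN STAGE 3.** Any earlier-stage certificate `C₁₂` over the
energy ball (e.g. `preCrossCertificate`), refined by the preload and retargeted to its hand-off
region, followed by `levelTransferStage` from that hand-off region: a `ReachCertificate` of length
`T₁₂ + T₃` from `Ain` to `outputLoaded E_out` (`ReachCertificate.comp`; compact hand-off tubes by
`isCompact_tube_of_modeBall`, joint closedness by `isClosed_energyTube_joint`) — verbatim the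
construction of `fullCycle`. [cite: Tao2016AveragedNS, §5.5 Thm 5.3 (5.5); §1.3 pp. 10–11] -/
def levelFullCycle {T₁₂ : ℝ} {Ain Amid : Set (Fin 5 → ℝ)} (ε σ ν μ r κ δ Rb T₃ Eout : ℝ)
    (C₁₂ : ReachCertificate (thresholdCircuit ε σ ν μ r κ) (modeBall Rb) δ T₁₂ Ain Amid)
    (Box : ℕ → (Fin 5 → ℝ) → Prop) (dur : ℕ → ℝ) (n : ℕ) (hT₁₂ : 0 ≤ T₁₂) (hT₃ : 0 < T₃)
    (hκ : 0 ≤ κ) (hδ : 0 ≤ δ) (hRb : 0 ≤ Rb) (hdur : ∀ k, 0 ≤ dur k)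
    (htime : ∑ k ∈ Finset.range n, dur k ≤ T₃)
    (hE : ∀ p ∈ (C₁₂.withPreload hκ).handoff, energy p + 10 * (δ * Rb) * T₃ < Rb ^ 2)
    (hin : ∀ p ∈ (C₁₂.withPreload hκ).handoff, Box 0 p)
    (hstep : ∀ k < n, ∀ y : ℝ → Fin 5 → ℝ, IsForcedWindow ε σ ν μ r κ δ (dur k) y →
      (∀ t ∈ Ico 0 (dur k), ∀ i, |y t i| < Rb) → Box k (y 0) →
        ∃ t ∈ Icc 0 (dur k), Box (k + 1) (y t))
    (hexit : ∀ X, Box n X → Eout ≤ X 4 ^ 2) :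
    ReachCertificate (thresholdCircuit ε σ ν μ r κ) (modeBall Rb) δ (T₁₂ + T₃) Ain
      (outputLoaded Eout) :=
  ((C₁₂.withPreload hκ).toHandoff hT₁₂).comp
    (levelTransferStage ε σ ν μ r κ δ Rb T₃ Eout (C₁₂.withPreload hκ).handoff Box dur n hκ hδ hRb
      hdur htime hE hin hstep hexit)
    hT₁₂ hT₃
    (fun _ hp => (C₁₂.withPreload hκ).tube_subset_handoff hp)
    (fun _ hp => (C₁₂.withPreload hκ).isCompact_tube_of_modeBall hRb hp ⟨hT₁₂, le_rfl⟩)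
    (fun _ hp => isClosed_energyTube_joint δ Rb T₃
      (((C₁₂.withPreload hκ).isCompact_tube_of_modeBall hRb hp ⟨hT₁₂, le_rfl⟩).isClosed))

/-- **REACH OF THE FULL CYCLE WITH A LEVEL-CHAIN STAGE 3, no region hypothesis**: every continuous
curve from `p ∈ Ain` with a `δ`-admissible right derivative on `[0, T₁₂ + T₃)` has its output loaded
to `E_out` at some time of `[0, T₁₂ + T₃]`. [cite: Tao2016AveragedNS, §5.5 Thm 5.3 (5.5)] -/
theorem levelFullCycle_reach {T₁₂ : ℝ} {Ain Amid : Set (Fin 5 → ℝ)} (ε σ ν μ r κ δ Rb T₃ Eout : ℝ)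
    (C₁₂ : ReachCertificate (thresholdCircuit ε σ ν μ r κ) (modeBall Rb) δ T₁₂ Ain Amid)
    (Box : ℕ → (Fin 5 → ℝ) → Prop) (dur : ℕ → ℝ) (n : ℕ) (hT₁₂ : 0 ≤ T₁₂) (hT₃ : 0 < T₃)
    (hκ : 0 ≤ κ) (hδ : 0 ≤ δ) (hRb : 0 ≤ Rb) (hdur : ∀ k, 0 ≤ dur k)
    (htime : ∑ k ∈ Finset.range n, dur k ≤ T₃)
    (hE : ∀ p ∈ (C₁₂.withPreload hκ).handoff, energy p + 10 * (δ * Rb) * T₃ < Rb ^ 2)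
    (hin : ∀ p ∈ (C₁₂.withPreload hκ).handoff, Box 0 p)
    (hstep : ∀ k < n, ∀ y : ℝ → Fin 5 → ℝ, IsForcedWindow ε σ ν μ r κ δ (dur k) y →
      (∀ t ∈ Ico 0 (dur k), ∀ i, |y t i| < Rb) → Box k (y 0) →
        ∃ t ∈ Icc 0 (dur k), Box (k + 1) (y t))
    (hexit : ∀ X, Box n X → Eout ≤ X 4 ^ 2)
    {p : Fin 5 → ℝ} (hp : p ∈ Ain) {x : ℝ → Fin 5 → ℝ} (hx0 : x 0 = p)
    (hcont : ContinuousOn x (Icc 0 (T₁₂ + T₃)))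
    (hder : ∀ s ∈ Ico 0 (T₁₂ + T₃), ∃ W : Fin 5 → ℝ, HasDerivWithinAt x W (Ici s) s ∧
      ‖W - thresholdCircuit ε σ ν μ r κ (x s)‖ ≤ δ) :
    ∃ s ∈ Icc 0 (T₁₂ + T₃), Eout ≤ x s 4 ^ 2 :=
  (levelFullCycle ε σ ν μ r κ δ Rb T₃ Eout C₁₂ Box dur n hT₁₂ hT₃ hκ hδ hRb hdur htime hE hin hstep
    hexit).reach (isOpen_modeBall Rb) hp (by linarith) hx0 hcont hder

end Literature.Analysis.FluidPDE.FluidComputer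

end
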